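import Literature.NumberTheory.EllipticCurves.NeronComponentIndexSplitProofs
import Literature.NumberTheory.EllipticCurves.TamagawaFiniteIndexProofs
import Literature.NumberTheory.EllipticCurves.TamagawaSubgroupProofs
import Literature.NumberTheory.EllipticCurves.MultiplicativeReductionJValuationProofs
import HarnessLib

/-!
# Route `TamagawaTwistDictionary`, crux `TamagawaTwistPayoff` (stmt-ABC-24114) — helper:
# Tate's `c_v = ord_v(Δ_min) = −ord_v(j)` read INSIDE the Tamagawa product

The BSD-side half of the twist dictionary «Conj 1.14 ⟹ sub-exponential Szpiro» (Pasten,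
JNT 254 (2024) = arXiv:1705.09251, remark after Thm 1.15, stated without proof): at a place `v`
of SPLIT multiplicative reduction of an elliptic curve `E` over a number field,

* `localTamagawaNumber_le_tamagawaProduct` — every local factor divides, hence is at most, the
  Tamagawa product `Tam(E) = ∏_w c_w` (all factors are finite indices `≥ 1`,
  `WeierstrassCurve.localTamagawaNumber_baseChange_ne_zero`, and only finitely many differ from
  `1`, `WeierstrassCurve.mulSupport_localTamagawaNumber_finite_holds` — so the `finprod` is an
  honest product);
* `ordMinimalDiscriminant_le_tamagawaProduct` — `ord_v(Δ_min E) = c_v ≤ Tam(E)` (Tate /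
  Kodaira–Néron, Silverman *ATAEC* Cor. IV.9.2 (d): the tree's
  `localTamagawaNumber_eq_ordMinimalDiscriminant_of_hasSplitMultiplicativeReductionAt`);
* `valuation_j_eq_exp_ordMinimalDiscriminant_of_split` / `jPole_le_tamagawaProduct` — and
  `ord_v(Δ_min E) = −ord_v(j_E)` there (Silverman *AEC* VII.5.1 (b)), so the POLE ORDER OF `j`
  at a split multiplicative place is at most `Tam(E)`.

HONESTY: classical local facts assembled for the line; NOT abc, NOT A-PS, and not the payoff by
itself. No `sorry`, no new axiom, no `def`.

References: J. H. Silverman, *Advanced Topics in the Arithmetic of Elliptic Curves* (1994),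
Cor. IV.9.2 (d); *The Arithmetic of Elliptic Curves* (2009), Prop. VII.5.1 (b), Cor. VII.6.2;
H. Pasten, J. Number Theory 254 (2024), Conj. 1.14 and the remark following Thm 1.15.
-/

noncomputable section

-- `Summit.<Summit>.<Problem>` is the mandated summit-side namespace (CONVENTIONS §2); for the
-- single-conjunct summit `ABC` the two coincide, so the duplicate `ABC.ABC` is deliberate.
set_option linter.dupNamespace false

namespace Summit.ABC.ABC.Theorems.TamagawaTwistPayoffLine

open scoped NumberField
open IsDedekindDomain WeierstrassCurve

variable {K : Type*} [Field K] [NumberField K] (W : WeierstrassCurve K) [W.IsElliptic]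
  (v : HeightOneSpectrum (𝓞 K))

/-- **`c_v ≤ Tam(E)`**: a local Tamagawa factor of an elliptic curve over a number field is at
most the Tamagawa product (all factors are `≥ 1` and almost all are `1`).
[cite: SilvermanAEC2009, Cor. VII.6.2 (PDF p. 177)] -/
theorem localTamagawaNumber_le_tamagawaProduct :
    (W.baseChange (v.adicCompletion K)).localTamagawaNumber (v.adicCompletionIntegers K) ≤
      W.tamagawaProduct := by
  classical
  have hfin := W.mulSupport_localTamagawaNumber_finite_holds
  unfold WeierstrassCurve.tamagawaProduct
  rw [finprod_eq_prod_of_mulSupport_subset _ (s := insert v hfin.toFinset)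
    (fun w hw => by
      rw [Finset.coe_insert, Set.Finite.coe_toFinset]
      exact Set.mem_insert_of_mem _ hw)]
  exact Finset.single_le_prod' (f := fun w : HeightOneSpectrum (𝓞 K) =>
      (W.baseChange (w.adicCompletion K)).localTamagawaNumber (w.adicCompletionIntegers K))
    (fun w _ => Nat.one_le_iff_ne_zero.mpr (W.localTamagawaNumber_baseChange_ne_zero w))
    (Finset.mem_insert_self v _)

/-- **`ord_v(Δ_min E) ≤ Tam(E)` at a place of split multiplicative reduction** (Tate's
`c_v = ord_v(Δ_min)`, Silverman ATAEC Cor. IV.9.2 (d), inside the product).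
[cite: SilvermanATAEC1994, Cor. IV.9.2(d)] -/
theorem ordMinimalDiscriminant_le_tamagawaProduct (hs : W.HasSplitMultiplicativeReductionAt v) :
    W.ordMinimalDiscriminant v ≤ W.tamagawaProduct := by
  rw [← Literature.NumberTheory.EllipticCurves.localTamagawaNumber_eq_ordMinimalDiscriminant_of_hasSplitMultiplicativeReductionAt
    v W hs]
  exact localTamagawaNumber_le_tamagawaProduct W v

/-- At a place of split multiplicative reduction `|j|_v = exp(ord_v Δ_min)`, i.e.
`ord_v(j) = −ord_v(Δ_min)` (Silverman AEC VII.5.1 (b); split ⇒ multiplicative).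
[cite: SilvermanAEC2009, Prop. VII.5.1(b)] -/
theorem valuation_j_eq_exp_ordMinimalDiscriminant_of_split
    (hs : W.HasSplitMultiplicativeReductionAt v) :
    v.valuation K W.j = WithZero.exp (W.ordMinimalDiscriminant v : ℤ) :=
  W.valuation_j_eq_exp_ordMinimalDiscriminant_of_hasMultiplicativeReductionAt v
    hs.hasMultiplicativeReductionAt

/-- **The pole order of `j` at a split multiplicative place is at most `Tam(E)`**: if
`|j_E|_v = exp(ν)` (`ord_v j_E = −ν`) and `E` has split multiplicative reduction at `v`, then
`ν = ord_v(Δ_min E) = c_v ≤ Tam(E)`. This is the local input of Pasten's remark «Conjecture 1.14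
… implies `log Δ_E ≪_ε N_E^ε`» (JNT 254 (2024), after Thm 1.15).
[cite: PastenShimura2024, Conjecture 1.14 and the remark following Theorem 1.15] -/
theorem jPole_le_tamagawaProduct (hs : W.HasSplitMultiplicativeReductionAt v) {ν : ℕ}
    (hν : v.valuation K W.j = WithZero.exp (ν : ℤ)) : ν ≤ W.tamagawaProduct := by
  have h := valuation_j_eq_exp_ordMinimalDiscriminant_of_split W v hs
  rw [hν] at h
  have hν' : (ν : ℤ) = W.ordMinimalDiscriminant v := WithZero.exp_injective h
  have : ν = W.ordMinimalDiscriminant v := by exact_mod_cast hν'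
  rw [this]
  exact ordMinimalDiscriminant_le_tamagawaProduct W v hs

end Summit.ABC.ABC.Theorems.TamagawaTwistPayoffLine

end
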